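import Summits.BirchSwinnertonDyer.Rank1Residual.X9.BigImageWitnesses
import Summits.BirchSwinnertonDyer.Rank1Residual.Partition.CornersAll
import Literature.NumberTheory.EllipticCurves.YanZhu2026.PPartBSD
import HarnessLib

/-!
# Yan–Zhu 2026 Thm. 4.15 (= J. Algebra 693 (2026) Thm. 5.11 / Cor. 1.4) at `p = 3`: every tree
# consumer RE-KEYED to the VERBATIM (Im) binder, in the kernel (cell `bsd-litref`, paper sub-dir
# `yz26`, seat `bsd-litref-yz26-pv`; LADDER-BSD rungs H1 / W7, scoreboard row D3)

HONEST FRAMING (programme `BSD-LIT2PART-PROGRAMME-v1.md` §HONESTY, verbatim): «no tranche here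
proves BSD; ARM L moves the LITERAL column of an r ≤ 1 census into the
kernel-proved-modulo-named-print column; ARM P changes what «named print» is worth.» Theorems
only; no named fact is introduced; nothing is asserted about Yan–Zhu's theorem — it stays a
hypothesis BY NAME. What changes is WHICH name: the refereed statement itself.

## What this file does

The tree carries Yan–Zhu's `p`-part theorem in TWO shapes (`Literature/…/YanZhu2026/PPartBSD.lean`):

* `YanZhu2026.thm415_padicValRat_bsd_rank_le_one_of_bigIm` — the PRINTED form: hypothesis (Im)
  itself ("there exists `τ ∈ Gal(ℚ̄/ℚ(μ_{p^∞}))` such that `T_pE/(ρ_E(τ) − 1)T_pE` is free of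
  `ℤ_p`-rank one", Thm. 1.2 display (Im); tree predicate `Rank1Residual.BigIm W p`);
* `YanZhu2026.thm415_padicValRat_bsd_rank_le_one` — the SPECIAL-CASE form used by 195 hypothesis
  binders in 85 tree files (partition rows C16, `Partition/Bsdp.lean`, the H1 headline
  `bsdp_allCurves_of_not_corner_of_not_cornerF`, the `KimAtThree…NonAdditiveRows` files, the
  additive `GordDescent…Three` files, the O5 transport files, …): (Im) replaced by the disjunction
  "`ρ_{E,p}` onto `GL₂(ℤ_p)` (all `ρ̄_{E,p^n}` onto) OR (ram): a multiplicative prime `ℓ ≠ p` with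
  `p ∤ v_ℓ(Δ_min)`", each alternative implying (Im) by an argument the binder's docstring CITES
  (Serre; Skinner, Pacific J. Math. 283 (2016) §2.5) but which, at the time that binder landed, was
  not a tree theorem.

Both implications ARE now kernel theorems of the tree (cell `b2b-bsdres`, seat x9 gen 9):
`X9.bigIm_of_hasSurjectiveModNGaloisRep_pow` (every `p`: `p`-adic surjectivity ⟹ (Im), by
compactness of `Γ_ℚ` and the Weil pairing) and `X9.bigIm_of_irr_of_ram` (every `p`:
(irr) ∧ (ram) ⟹ surj ⟹ `p`-adic surjectivity ⟹ (Im), the inertia transvection at `ℓ` plus Serre's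
Prop. 15). Hence:

1. `yanZhu_thm415_of_thm415_of_bigIm` — **the special-case binder FOLLOWS from the verbatim (Im)
   binder**, sorry-free, standard axioms. Every one of the 195 consumers is thereby re-keyed to the
   refereed statement by name: feed `yanZhu_thm415_of_thm415_of_bigIm hYZ` where `hYZ` is the
   printed form. No consumer file is edited (append-only tree).
2. `RowC16.surj`, `RowC16.threeAdicSurjective`, `RowC16.bigIm` — **per-class re-derivation on row
   C16 = scoreboard row D3** (`p = 3`, good ordinary, `E[3]` irreducible, surj(3) ∨ ram(3); 4 814
   literal classes `N < 5·10⁵`): the (ram) alternative lies INSIDE the surj alternative at an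
   irreducible `3` (kernel, no named fact), so granted Wuthrich 2014 Lemma 20 (`hW20`, the row's
   own second named fact) EVERY class of the row has `ρ_{E,3}` onto `GL₂(ℤ₃)` and satisfies (Im).
   Consequence for the D-audit: whichever image hypothesis a referee reads into the journal text
   at `p = 3` — (Im) as printed (Thm. 1.2 / Cor. 5.4), or "`Im(ρ_E) ⊃ SL₂(ℤ_p)`" (the condition
   §4.3 says is literally used: "the condition `Im(ρ_E) ⊃ SL₂(ℤ_p)` is used, but it can be
   replaced by (Im) as discussed in the last paragraph of [ski2016]"), or full `3`-adic image —
   the row's 4 814 classes meet it; no class of D3 hangs on the (ram) ⟹ (Im) remark.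
3. `RowC16.bsdp_of_imForm` and `bsdp_allCurves_of_not_corner_of_not_cornerF_of_imForm` — row C16
   and the H1 headline (`Partition/CornersAll.lean`, p242811) with the Yan–Zhu input taken in its
   PRINTED form; the other thirteen named facts unchanged.

What this does NOT touch: the cell flag `YZ26@3-BF-ERL-Ohta` (the `p = 3` Λ-adic Eichler–Shimura /
Beilinson–Flach reciprocity input of Yan–Zhu's PROOF, refereed in cell by the reader seats
`bsd-litref-yz26-r1` / `-r2`; HOME `run/shared/lean/pub/bsd-litref/yz26/`). The flag travels with the
fact under either name.

References: X. Yan, X. Zhu, J. Algebra 693 (2026) 372–402 = arXiv:2412.20078v4, Thm. 1.2 (Im),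
Cor. 1.4, Thm. 5.11 (= v2 Thm. 4.15), §4.3; C. Skinner, Pacific J. Math. 283 (2016) §2.5;
C. Wuthrich, Doc. Math. 19 (2014) Lemma 20; tree `X9/SurjBigImage.lean`, `X9/BigImageWitnesses.lean`,
`Rank1Residual/X9NoEntry.lean` (`surj_of_irr_of_ram`), `Partition/Bsdp.lean`, `Partition/CornersAll.lean`.
-/

set_option autoImplicit false

noncomputable section

open scoped Classical

open WeierstrassCurve Literature.NumberTheory.EllipticCurves
  Literature.NumberTheory.EllipticCurves.Rank1Residual Literature.NumberTheory.EllipticCurves.ModularForms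

namespace Summit.BirchSwinnertonDyer.Rank1Residual

/-! ### §1 The special-case binder is a consequence of the printed (Im) binder -/

/-- **Yan–Zhu 2026 Thm. 4.15 / 5.11: the tree's special-case binder follows from the VERBATIM (Im)
binder.** Given the printed form `thm415_padicValRat_bsd_rank_le_one_of_bigIm` (hypothesis
`BigIm W p` = (Im)), the special-case form `thm415_padicValRat_bsd_rank_le_one` (hypothesis
"`p`-adic surjectivity ∨ (ram)") holds: the first alternative gives (Im) by
`X9.bigIm_of_hasSurjectiveModNGaloisRep_pow` (Serre's `(1 1; 0 1) ∈ SL₂(ℤ_p) = ρ_E(G_{ℚ(μ_{p^∞})})`,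
as a kernel theorem on the tree's Tate module), the second by `X9.bigIm_of_irr_of_ram` ((irr) +
(ram) ⟹ surj ⟹ `p`-adic surjectivity ⟹ (Im): the inertia transvection, Serre Prop. 15 — Skinner
2016 §2.5's mechanism as a kernel theorem). So every consumer of the special-case binder is a
consumer of the refereed statement by name. [cite: YanZhu2024MainConjNonCM, Thm. 4.15 (§4.6) = Cor. 1.4, hypothesis (Im)] -/
theorem yanZhu_thm415_of_thm415_of_bigIm
    (hYZ : YanZhu2026.thm415_padicValRat_bsd_rank_le_one_of_bigIm) :
    YanZhu2026.thm415_padicValRat_bsd_rank_le_one := by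
  intro W _ _ p _ hp hgood hord hirr hIm hr
  refine hYZ W p hp hgood hord hirr ?_ hr
  rcases hIm with hs | hram
  · exact X9.bigIm_of_hasSurjectiveModNGaloisRep_pow W p hs
  · exact X9.bigIm_of_irr_of_ram W p hirr hram

/-! ### §2 Row C16 (scoreboard row D3): the image hypothesis in its strongest form, per class -/

section Curve

variable {W : WeierstrassCurve ℚ} [W.IsElliptic] [W.IsGloballyMinimal] {p : ℕ} [Fact p.Prime]

/-- **Row C16 ⟹ surj(3)** (kernel; no named fact): on row C16 (`p = 3`, good ordinary, `E[3]`
irreducible, surj(3) ∨ ram(3)) the (ram) alternative already forces `ρ̄_{E,3}` onto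
(`surj_of_irr_of_ram`: inertia transvection + Serre Prop. 15), so the row's image disjunction is
just surj(3). [folklore] -/
theorem RowC16.surj (h : RowC16 W p) : Surj W p := by
  obtain ⟨-, -, hirr, hs | hram⟩ := h
  · exact hs
  · exact surj_of_irr_of_ram W p hirr hram

/-- **Row C16 ⟹ `ρ_{E,3}` onto `GL₂(ℤ₃)`** (every `ρ̄_{E,3^n}` onto), granted Wuthrich 2014 Lemma
20 (`hW20`: at a good or multiplicative `3`, surj(3) lifts to all levels — Elkies' exotic `9`-adic
images are additive at `3`). So every class of scoreboard row D3 meets the STRONGEST image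
hypothesis a reader may extract from Yan–Zhu §4.3 ("the condition `Im(ρ_E) ⊃ SL₂(ℤ_p)` is used").
[cite: Wuthrich2014, Lemma 20 (p. 399)] -/
theorem RowC16.threeAdicSurjective
    (hW20 : Wuthrich2014.lemma20_surjective_threeAdic_of_semistable) (h : RowC16 W p) :
    ∀ n : ℕ, W.HasSurjectiveModNGaloisRep (3 ^ n : ℕ) := by
  have hs : Surj W p := RowC16.surj h
  obtain ⟨rfl, hord, -, -⟩ := h
  exact hW20 W (Or.inl hord.1) hs

/-- **Row C16 ⟹ (Im) at `3`** (`BigIm W 3`), granted Wuthrich 2014 Lemma 20: the printed hypothesis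
of Yan–Zhu's theorem holds on EVERY class of row C16 / D3, by `RowC16.threeAdicSurjective` and
`X9.bigIm_of_hasSurjectiveModNGaloisRep_pow`. [cite: Wuthrich2014, Lemma 20 (p. 399)] -/
theorem RowC16.bigIm (hW20 : Wuthrich2014.lemma20_surjective_threeAdic_of_semistable)
    (h : RowC16 W p) : BigIm W p := by
  have h3 := RowC16.threeAdicSurjective hW20 h
  obtain ⟨rfl, -, -, -⟩ := h
  exact X9.bigIm_of_hasSurjectiveModNGaloisRep_pow W 3 h3

/-! ### §3 Row C16 and the H1 headline keyed on the printed (Im) binder -/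

/-- **C16 ⟹ `BSD(E,3)` from the PRINTED (Im) form of Yan–Zhu 2026 Thm. 4.15 / 5.11** (`hYZ`),
Wuthrich 2014 Lemma 20 (`hW20`), modularity (`hmod`), Gross–Zagier–Kolyvagin (`hGZK`): the row's
image disjunction gives (Im) (`RowC16.bigIm`), then `Rank1Residual.bsdp_of_goodOrd_irr_bigIm`.
Same conclusion as `RowC16.bsdp` (`Partition/Bsdp.lean`), one interpretive step fewer in the
trust base (the fact is the journal statement verbatim). PUB\* flag `YZ26@3-BF-ERL-Ohta` travels
with the fact. [cite: YanZhu2024MainConjNonCM, Thm. 4.15 (§4.6) = Cor. 1.4, hypothesis (Im)] -/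
theorem RowC16.bsdp_of_imForm (hYZ : YanZhu2026.thm415_padicValRat_bsd_rank_le_one_of_bigIm)
    (hW20 : Wuthrich2014.lemma20_surjective_threeAdic_of_semistable)
    (hmod : hasEntireLFunction_rat) (hGZK : rank_eq_analyticRank_of_analyticRank_le_one)
    (hr : W.analyticRank ≤ 1) (h : RowC16 W p) : BSDp W p := by
  have him := RowC16.bigIm hW20 h
  obtain ⟨rfl, hord, hirr, -⟩ := h
  exact bsdp_of_goodOrd_irr_bigIm hYZ hGZK hmod 3 le_rfl hord hirr him hr

/-- **The H1 headline with Yan–Zhu's input in its PRINTED form.** Identical to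
`bsdp_allCurves_of_not_corner_of_not_cornerF` (`Partition/CornersAll.lean`, p242811: `BSD(E,p)` for
every analytic-rank `≤ 1` curve on the domain "CM, or `p` odd with `p` good or (`p` multiplicative
and `r = 0`)" outside the eight non-CM corners and the CM corner `CornerF`, granted fourteen named
published facts) except that the Yan–Zhu binder is `thm415_padicValRat_bsd_rank_le_one_of_bigIm`
(hypothesis (Im) verbatim) — bridged by `yanZhu_thm415_of_thm415_of_bigIm`.
[cite: YanZhu2024MainConjNonCM, Thm. 4.15 (§4.6) = Cor. 1.4, hypothesis (Im)] -/
theorem bsdp_allCurves_of_not_corner_of_not_cornerF_of_imForm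
    (hSk : Skinner2016.thmC_padicValRat_bsd_rank_zero)
    (hBCS : BurungaleCastellaSkinner2025.cor131_padicValRat_bsd_rank_le_one)
    (hJSW : JetchevSkinnerWan2017.thm121_padicValRat_bsd_rank_one)
    (hCGS : CastellaGrossiSkinner2025.thmD_padicValRat_bsd_rank_le_one)
    (hGV : GreenbergVatsal2000.thm13_charIdeal_eq_of_gvPar) (hGr : greenberg_charValue_rankZero)
    (hmod : hasEntireLFunction_rat) (hmodP : nonempty_modularParametrizationData)
    (hGZK : rank_eq_analyticRank_of_analyticRank_le_one)
    (hCM : bsdTriple_of_hasCM_of_L_one_ne_zero) (hKob : Kobayashi2013.cor14_bsdp_of_cm_rank_one)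
    (hYZ : YanZhu2026.thm415_padicValRat_bsd_rank_le_one_of_bigIm)
    (hW20 : Wuthrich2014.lemma20_surjective_threeAdic_of_semistable)
    (hLLT : LiLiuTian2024.thm11_bsdp_of_cm_rank_one)
    (hr : W.analyticRank ≤ 1)
    (hdom : W.HasCM ∨ (p ≠ 2 ∧ (Good W p ∨ (Mult W p ∧ W.analyticRank = 0))))
    (hA : ¬ W.HasCM → ¬ ClassX1 W p ∧ ¬ ClassX9 W p ∧ ¬ (ClassX10 W p ∧ ¬ Surj W p) ∧
      ¬ (ClassX6 W p ∧ W.analyticRank = 0) ∧ ¬ ClassX7 W p ∧ ¬ ClassX8 W p ∧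
      ¬ ClassX11a W p ∧ ¬ ClassX2 W p)
    (hF : W.HasCM → ¬ CornerF W p) : BSDp W p :=
  bsdp_allCurves_of_not_corner_of_not_cornerF hSk hBCS hJSW hCGS hGV hGr hmod hmodP hGZK hCM hKob
    (yanZhu_thm415_of_thm415_of_bigIm hYZ) hW20 hLLT hr hdom hA hF

end Curve

end Summit.BirchSwinnertonDyer.Rank1Residual

end
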